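import Mathlib.Topology.MetricSpace.Thickening
import Mathlib.Topology.MetricSpace.ProperSpace.Real
import Literature.Analysis.FluidPDE.BallisticFreeEnergyEstimates
import HarnessLib

/-!
# Uniform coercivity of the thermal relative energy (Březina–Feireisl 2018, (3.8))

For an equation of state with Gibbs' relation, thermodynamic stability and `e > 0`, and a compact
set `K ⊂ (0,∞)²` of reference states `(r, Θ)`, the thermal relative energy
`R(ρ,ϑ | r,Θ) = H_Θ(ρ,ϑ) - ∂_ρH_Θ(r,Θ)(ρ - r) - H_Θ(r,Θ)` of `BallisticFreeEnergy.lean` satisfies,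
uniformly in `(r,Θ) ∈ K` and `(ρ,ϑ) ∈ (0,∞)²`:

* (essential region) `R ≥ c ((ρ-r)² + (ϑ-Θ)²)` whenever `|ρ - r|, |ϑ - Θ| ≤ δ`
  (`relEnergyThermo_coercivity_near_far`, first clause);
* (residual region) `R ≥ c` whenever `|ρ - r| ≥ δ` or `|ϑ - Θ| ≥ δ` (second clause);
* (growth) `ρ ≤ C (1 + R)` (`density_le_of_relEnergyThermo`), `ρ e(ρ,ϑ) ≤ C (1 + ρ + R)` and
  `ρ |s(ρ,ϑ)| ≤ C (1 + ρ + R)` (`energy_entropy_le_of_relEnergyThermo`).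

Together these give BF's coercivity (3.8),
`E(ρ,E,m | r,Θ,U) ≳ [|ρ-r|² + |ϑ-Θ|² + |m/ρ - U|²]_ess + [1 + ρ + ρ|s| + ρe + |m|²/ρ]_res`,
which BF quote from Feireisl–Novotný 2009, Ch. 3, Prop. 3.2. The growth part is where `e > 0`
enters (via `f/ϑ` decreasing at rate `e/ϑ²`, `BallisticFreeEnergyEstimates.e_mul_inv_sub_inv_le`);
this is the justification for using [FN2009] at the generality of `MVWeakStrongUniqueness.lean`.

## References

* J. Březina, E. Feireisl, J. Math. Soc. Japan 70 (2018) 1227–1245, (3.8).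
* E. Feireisl, A. Novotný, *Singular limits in thermodynamics of viscous fluids* (2009), Ch. 3,
  Prop. 3.2.
-/

noncomputable section

open Set Filter Function Metric
open scoped Topology

namespace Literature.Analysis.FluidPDE

namespace CompressibleEuler

namespace EulerEOS

variable {eos : EulerEOS}

/-! ## Compactness helpers -/

/-- A continuous function on a compact set is bounded in absolute value by a non-negative constant.
[folklore] -/
theorem exists_nonneg_forall_abs_le_of_continuousOn {S : Set (ℝ × ℝ)} {f : ℝ × ℝ → ℝ}
    (hS : IsCompact S) (hf : ContinuousOn f S) :
    ∃ C : ℝ, 0 ≤ C ∧ ∀ z ∈ S, |f z| ≤ C := by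
  obtain ⟨C, hC⟩ := hS.exists_bound_of_continuousOn hf
  exact ⟨max C 0, le_max_right _ _, fun z hz =>
    (Real.norm_eq_abs (f z) ▸ hC z hz).trans (le_max_left _ _)⟩

/-- Points of the closed `δ`-box around a point of `K` lie in the closed `δ`-thickening of `K`
(sup metric on `ℝ × ℝ`). [folklore] -/
theorem mem_cthickening_of_abs_le {K : Set (ℝ × ℝ)} {r Θ ρ ϑ δ : ℝ} (h : (r, Θ) ∈ K)
    (hρ : |ρ - r| ≤ δ) (hϑ : |ϑ - Θ| ≤ δ) : (ρ, ϑ) ∈ cthickening δ K := by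
  refine mem_cthickening_of_dist_le (ρ, ϑ) (r, Θ) δ K h ?_
  rw [Prod.dist_eq, Real.dist_eq, Real.dist_eq]
  exact max_le hρ hϑ

/-! ## Continuity of the thermodynamic potentials on the open quadrant -/

/-- `(ρ,Θ) ↦ μ(ρ,Θ)` is continuous on `(0,∞)²`. [folklore] -/
theorem IsGibbs.continuousOn_chemPotential (hG : eos.IsGibbs) :
    ContinuousOn (fun z : ℝ × ℝ => eos.chemPotential z.1 z.2) (Ioi 0 ×ˢ Ioi 0) := by
  have he : ContinuousOn (fun z : ℝ × ℝ => eos.e z.1 z.2) (Ioi 0 ×ˢ Ioi 0) := hG.2.1.continuousOn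
  have hs : ContinuousOn (fun z : ℝ × ℝ => eos.s z.1 z.2) (Ioi 0 ×ˢ Ioi 0) := hG.2.2.1.continuousOn
  have hp : ContinuousOn (fun z : ℝ × ℝ => eos.p z.1 z.2) (Ioi 0 ×ˢ Ioi 0) := hG.1.continuousOn
  unfold chemPotential
  exact (he.sub (continuousOn_snd.mul hs)).add
    (hp.div continuousOn_fst fun z hz => ne_of_gt hz.1)

/-- `(ρ,Θ) ↦ H_Θ(ρ,Θ)` is continuous on `(0,∞)²`. [folklore] -/
theorem IsGibbs.continuousOn_ballisticFreeEnergy_diag (hG : eos.IsGibbs) :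
    ContinuousOn (fun z : ℝ × ℝ => eos.ballisticFreeEnergy z.2 z.1 z.2) (Ioi 0 ×ˢ Ioi 0) := by
  have he : ContinuousOn (fun z : ℝ × ℝ => eos.e z.1 z.2) (Ioi 0 ×ˢ Ioi 0) := hG.2.1.continuousOn
  have hs : ContinuousOn (fun z : ℝ × ℝ => eos.s z.1 z.2) (Ioi 0 ×ˢ Ioi 0) := hG.2.2.1.continuousOn
  unfold ballisticFreeEnergy
  exact (continuousOn_fst.mul he).sub (continuousOn_snd.mul (continuousOn_fst.mul hs))

/-- `(ρ,ϑ) ↦ f(ρ,ϑ)` is continuous on `(0,∞)²`. [folklore] -/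
theorem IsGibbs.continuousOn_helmholtz (hG : eos.IsGibbs) :
    ContinuousOn (fun z : ℝ × ℝ => eos.helmholtz z.1 z.2) (Ioi 0 ×ˢ Ioi 0) := by
  have he : ContinuousOn (fun z : ℝ × ℝ => eos.e z.1 z.2) (Ioi 0 ×ˢ Ioi 0) := hG.2.1.continuousOn
  have hs : ContinuousOn (fun z : ℝ × ℝ => eos.s z.1 z.2) (Ioi 0 ×ˢ Ioi 0) := hG.2.2.1.continuousOn
  unfold helmholtz
  exact he.sub (continuousOn_snd.mul hs)

/-! ## Uniform constants near a compact set of reference states -/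

/-- **Uniform local constants.** For `K ⊂ (0,∞)²` compact there are `δ, m₁, m₂, ρmin > 0` such
that the closed `δ`-box (sup metric) around every `(r,Θ) ∈ K` lies in `(0,∞)²` and on it
`ρ ≥ ρmin`, `∂_ϑ s ≥ m₁`, `∂_ρ p / ρ ≥ m₂` (compactness of the `δ`-thickening and continuity of
the partial derivatives). [folklore] -/
theorem coercivity_constants (hG : eos.IsGibbs) (hS : eos.IsThermodynamicallyStable)
    {K : Set (ℝ × ℝ)} (hK : IsCompact K) (hKq : K ⊆ Ioi 0 ×ˢ Ioi 0) :
    ∃ δ m₁ m₂ ρmin : ℝ, 0 < δ ∧ 0 < m₁ ∧ 0 < m₂ ∧ 0 < ρmin ∧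
      ∀ r Θ ρ ϑ : ℝ, (r, Θ) ∈ K → |ρ - r| ≤ δ → |ϑ - Θ| ≤ δ →
        0 < ρ ∧ 0 < ϑ ∧ ρmin ≤ ρ ∧ m₁ ≤ deriv (fun θ => eos.s ρ θ) ϑ ∧
          m₂ ≤ deriv (fun x => eos.p x ϑ) ρ / ρ := by
  obtain ⟨δ, hδ, hK'Q⟩ := hK.exists_cthickening_subset_open isOpen_quadrant hKq
  have hK'c : IsCompact (cthickening δ K) := hK.cthickening
  have hK'pos : ∀ {z : ℝ × ℝ}, z ∈ cthickening δ K → 0 < z.1 ∧ 0 < z.2 := fun hz => hK'Q hz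
  obtain ⟨m₁, hm₁, hm₁le⟩ : ∃ m₁ : ℝ, 0 < m₁ ∧
      ∀ z ∈ cthickening δ K, m₁ ≤ deriv (fun θ => eos.s z.1 θ) z.2 :=
    hK'c.exists_forall_le'
      ((continuousOn_deriv_slice_snd hG.2.2.1 isOpen_quadrant le_rfl).mono hK'Q)
      fun z hz => deriv_s_theta_pos hG hS (hK'pos hz).1 (hK'pos hz).2
  obtain ⟨m₂, hm₂, hm₂le⟩ : ∃ m₂ : ℝ, 0 < m₂ ∧
      ∀ z ∈ cthickening δ K, m₂ ≤ deriv (fun x => eos.p x z.2) z.1 / z.1 :=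
    hK'c.exists_forall_le'
      (((continuousOn_deriv_slice_fst hG.1 isOpen_quadrant le_rfl).div continuousOn_fst
        fun z hz => ne_of_gt hz.1).mono hK'Q)
      fun z hz => deriv_chemPotential_rho_pos hS (hK'pos hz).1 (hK'pos hz).2
  obtain ⟨ρmin, hρmin, hρminle⟩ : ∃ ρmin : ℝ, 0 < ρmin ∧ ∀ z ∈ cthickening δ K, ρmin ≤ z.1 :=
    hK'c.exists_forall_le' continuousOn_fst fun z hz => (hK'pos hz).1
  refine ⟨δ, m₁, m₂, ρmin, hδ, hm₁, hm₂, hρmin, fun r Θ ρ ϑ hrΘ hρ hϑ => ?_⟩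
  have hmem : (ρ, ϑ) ∈ cthickening δ K := mem_cthickening_of_abs_le hrΘ hρ hϑ
  exact ⟨(hK'pos hmem).1, (hK'pos hmem).2, hρminle _ hmem, hm₁le _ hmem, hm₂le _ hmem⟩

/-! ## Essential and residual coercivity -/

/-- **Coercivity near and far from the reference state** (first two clauses of BF (3.8)):
for `K ⊂ (0,∞)²` compact there are `δ, c > 0` with the `δ`-box around every `(r,Θ) ∈ K`
inside `(0,∞)²`, `R(ρ,ϑ | r,Θ) ≥ c((ρ-r)² + (ϑ-Θ)²)` on that box, and `R ≥ c` off it, for all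
`ρ, ϑ > 0`. [cite: BrezinaFeireisl2018, (3.8)] -/
theorem relEnergyThermo_coercivity_near_far (hG : eos.IsGibbs)
    (hS : eos.IsThermodynamicallyStable) {K : Set (ℝ × ℝ)} (hK : IsCompact K)
    (hKq : K ⊆ Ioi 0 ×ˢ Ioi 0) :
    ∃ δ c : ℝ, 0 < δ ∧ 0 < c ∧ (∀ r Θ : ℝ, (r, Θ) ∈ K → δ < r ∧ δ < Θ) ∧
      ∀ r Θ ρ ϑ : ℝ, (r, Θ) ∈ K → 0 < ρ → 0 < ϑ →
        (|ρ - r| ≤ δ → |ϑ - Θ| ≤ δ →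
          c * ((ρ - r) ^ 2 + (ϑ - Θ) ^ 2) ≤ eos.relEnergyThermo r Θ ρ ϑ) ∧
        ((δ ≤ |ρ - r| ∨ δ ≤ |ϑ - Θ|) → c ≤ eos.relEnergyThermo r Θ ρ ϑ) := by
  obtain ⟨δ, m₁, m₂, ρmin, hδ, hm₁, hm₂, hρmin, hK'⟩ := coercivity_constants hG hS hK hKq
  -- elementary absolute values
  have habs0 : ∀ a : ℝ, |a - a| ≤ δ := fun a => by simp [hδ.le]
  have habs1 : ∀ a : ℝ, |a - δ - a| ≤ δ := fun a => by
    rw [show a - δ - a = -δ by ring, abs_neg, abs_of_pos hδ]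
  have habs2 : ∀ a : ℝ, |a + δ - a| ≤ δ := fun a => by
    rw [show a + δ - a = δ by ring, abs_of_pos hδ]
  -- the constant
  obtain ⟨c, hc, hc1, hc2, hc3, hc4⟩ : ∃ c : ℝ, 0 < c ∧ c ≤ m₂ / 2 ∧ c ≤ m₁ * ρmin / 2 ∧
      c ≤ m₂ / 2 * δ ^ 2 ∧ c ≤ m₁ * ρmin / 2 * δ ^ 2 := by
    refine ⟨min (min (m₂ / 2) (m₁ * ρmin / 2)) (min (m₂ / 2 * δ ^ 2) (m₁ * ρmin / 2 * δ ^ 2)),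
      ?_, ?_, ?_, ?_, ?_⟩
    · refine lt_min (lt_min (by positivity) (by positivity)) (lt_min (by positivity) (by positivity))
    · exact (min_le_left _ _).trans (min_le_left _ _)
    · exact (min_le_left _ _).trans (min_le_right _ _)
    · exact (min_le_right _ _).trans (min_le_left _ _)
    · exact (min_le_right _ _).trans (min_le_right _ _)
  refine ⟨δ, c, hδ, hc, fun r Θ hrΘ => ?_, fun r Θ ρ ϑ hrΘ hρ hϑ => ?_⟩
  · have h1 := hK' r Θ (r - δ) Θ hrΘ (habs1 r) (habs0 Θ)
    have h2 := hK' r Θ r (Θ - δ) hrΘ (habs0 r) (habs1 Θ)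
    exact ⟨by linarith [h1.1], by linarith [h2.2.1]⟩
  have hr : 0 < r := (hKq hrΘ).1
  have hΘ : 0 < Θ := (hKq hrΘ).2
  have hrδ : 0 < r - δ := (hK' r Θ (r - δ) Θ hrΘ (habs1 r) (habs0 Θ)).1
  have hΘδ : 0 < Θ - δ := (hK' r Θ r (Θ - δ) hrΘ (habs0 r) (habs1 Θ)).2.1
  -- structure of `R`
  have hsplit := eos.relEnergyThermo_split r Θ ρ ϑ
  have hR₀_nonneg : 0 ≤ eos.relEnergyThermo r Θ ρ Θ := relEnergyThermo_diag_nonneg hG hS hr hΘ hρ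
  have hHdiff_nonneg : 0 ≤ eos.ballisticFreeEnergy Θ ρ ϑ - eos.ballisticFreeEnergy Θ ρ Θ := by
    have := ballisticFreeEnergy_self_le hG hS (Θ := Θ) hρ hϑ hΘ; linarith
  -- derivative bounds along the isotherm / isochores through the box
  have hm₂_iso : ∀ ξ ∈ Icc (r - δ) (r + δ), m₂ ≤ deriv (fun x => eos.p x Θ) ξ / ξ := fun ξ hξ =>
    (hK' r Θ ξ Θ hrΘ (abs_le.2 ⟨by linarith [hξ.1], by linarith [hξ.2]⟩) (habs0 Θ)).2.2.2.2
  have hm₁_iso : ∀ {ρ' : ℝ}, |ρ' - r| ≤ δ →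
      ∀ τ ∈ Icc (Θ - δ) (Θ + δ), m₁ ≤ deriv (fun θ => eos.s ρ' θ) τ := fun hρ' τ hτ =>
    (hK' r Θ _ τ hrΘ hρ' (abs_le.2 ⟨by linarith [hτ.1], by linarith [hτ.2]⟩)).2.2.2.1
  -- quadratic bounds on the box
  have hquad_ρ : ∀ {ρ' : ℝ}, ρ' ∈ Icc (r - δ) (r + δ) →
      m₂ / 2 * (ρ' - r) ^ 2 ≤ eos.relEnergyThermo r Θ ρ' Θ := fun hρ' =>
    relEnergyThermo_diag_ge_sq hG hΘ hrδ hδ.le hm₂_iso hρ'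
  have hquad_ϑ : ∀ {ρ' ϑ' : ℝ}, |ρ' - r| ≤ δ → ϑ' ∈ Icc (Θ - δ) (Θ + δ) →
      m₁ * ρmin / 2 * (ϑ' - Θ) ^ 2 ≤
        eos.ballisticFreeEnergy Θ ρ' ϑ' - eos.ballisticFreeEnergy Θ ρ' Θ := by
    intro ρ' ϑ' hρ' hϑ'
    have hdat := hK' r Θ ρ' Θ hrΘ hρ' (habs0 Θ)
    have h1 := ballisticFreeEnergy_sub_ge_sq hG hdat.1 hΘδ hδ.le (hm₁_iso hρ') hϑ'
    have h3 : m₁ * ρmin / 2 ≤ m₁ * ρ' / 2 := by nlinarith [hdat.2.2.1]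
    have := mul_le_mul_of_nonneg_right h3 (sq_nonneg (ϑ' - Θ))
    linarith
  refine ⟨fun hρr hϑΘ => ?_, fun hfar => ?_⟩
  · -- essential region
    have hρI : ρ ∈ Icc (r - δ) (r + δ) :=
      ⟨by linarith [(abs_le.1 hρr).1], by linarith [(abs_le.1 hρr).2]⟩
    have hϑI : ϑ ∈ Icc (Θ - δ) (Θ + δ) :=
      ⟨by linarith [(abs_le.1 hϑΘ).1], by linarith [(abs_le.1 hϑΘ).2]⟩
    have h1 := hquad_ρ hρI
    have h2 := hquad_ϑ hρr hϑI
    have e1 := mul_le_mul_of_nonneg_right hc1 (sq_nonneg (ρ - r))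
    have e2 := mul_le_mul_of_nonneg_right hc2 (sq_nonneg (ϑ - Θ))
    rw [hsplit, mul_add]
    linarith
  · -- residual region
    by_cases hρfar : δ ≤ |ρ - r|
    · -- far in density: the isotherm
      suffices h : m₂ / 2 * δ ^ 2 ≤ eos.relEnergyThermo r Θ ρ Θ by rw [hsplit]; linarith
      rcases le_or_gt r ρ with hle | hlt
      · have hρ' : r + δ ≤ ρ := by
          rw [abs_of_nonneg (by linarith)] at hρfar; linarith
        have h1 : eos.relEnergyThermo r Θ (r + δ) Θ ≤ eos.relEnergyThermo r Θ ρ Θ :=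
          monotoneOn_relEnergyThermo_diag hG hS hr hΘ (show r ≤ r + δ by linarith) hle hρ'
        have h2 := hquad_ρ (show r + δ ∈ Icc (r - δ) (r + δ) from ⟨by linarith, le_refl _⟩)
        have : m₂ / 2 * (r + δ - r) ^ 2 = m₂ / 2 * δ ^ 2 := by ring
        linarith
      · have hρ' : ρ ≤ r - δ := by
          rw [abs_of_neg (by linarith)] at hρfar; linarith
        have h1 : eos.relEnergyThermo r Θ (r - δ) Θ ≤ eos.relEnergyThermo r Θ ρ Θ :=
          antitoneOn_relEnergyThermo_diag hG hS hρ hr hΘ ⟨le_refl _, hlt.le⟩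
            ⟨hρ', by linarith⟩ hρ'
        have h2 := hquad_ρ (show r - δ ∈ Icc (r - δ) (r + δ) from ⟨le_refl _, by linarith⟩)
        have : m₂ / 2 * (r - δ - r) ^ 2 = m₂ / 2 * δ ^ 2 := by ring
        linarith
    · -- near in density, far in temperature: the isochore
      have hρr : |ρ - r| ≤ δ := le_of_lt (not_le.1 hρfar)
      have hϑfar : δ ≤ |ϑ - Θ| := hfar.resolve_left hρfar
      suffices h : m₁ * ρmin / 2 * δ ^ 2 ≤
          eos.ballisticFreeEnergy Θ ρ ϑ - eos.ballisticFreeEnergy Θ ρ Θ by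
        rw [hsplit]; linarith
      rcases le_or_gt Θ ϑ with hle | hlt
      · have hϑ' : Θ + δ ≤ ϑ := by
          rw [abs_of_nonneg (by linarith)] at hϑfar; linarith
        have h1 : eos.ballisticFreeEnergy Θ ρ (Θ + δ) ≤ eos.ballisticFreeEnergy Θ ρ ϑ :=
          monotoneOn_ballisticFreeEnergy_theta hG hS hρ hΘ (show Θ ≤ Θ + δ by linarith) hle hϑ'
        have h2 := hquad_ϑ hρr (show Θ + δ ∈ Icc (Θ - δ) (Θ + δ) from ⟨by linarith, le_refl _⟩)
        have : m₁ * ρmin / 2 * (Θ + δ - Θ) ^ 2 = m₁ * ρmin / 2 * δ ^ 2 := by ring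
        linarith
      · have hϑ' : ϑ ≤ Θ - δ := by
          rw [abs_of_neg (by linarith)] at hϑfar; linarith
        have h1 : eos.ballisticFreeEnergy Θ ρ (Θ - δ) ≤ eos.ballisticFreeEnergy Θ ρ ϑ :=
          antitoneOn_ballisticFreeEnergy_theta hG hS (Θ := Θ) hρ ⟨hϑ, hlt.le⟩
            ⟨hΘδ, by linarith⟩ hϑ'
        have h2 := hquad_ϑ hρr (show Θ - δ ∈ Icc (Θ - δ) (Θ + δ) from ⟨le_refl _, by linarith⟩)
        have : m₁ * ρmin / 2 * (Θ - δ - Θ) ^ 2 = m₁ * ρmin / 2 * δ ^ 2 := by ring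
        linarith

/-! ## Growth bounds -/

/-- **Density is controlled by the relative energy**: for `K ⊂ (0,∞)²` compact there is `C > 0`
with `ρ ≤ C (1 + R(ρ,ϑ | r,Θ))` for all `(r,Θ) ∈ K`, `ρ, ϑ > 0` (linear growth of the strictly
convex `ρ ↦ H_Θ(ρ,Θ)`). [cite: BrezinaFeireisl2018, (3.8)] -/
theorem density_le_of_relEnergyThermo (hG : eos.IsGibbs) (hS : eos.IsThermodynamicallyStable)
    {K : Set (ℝ × ℝ)} (hK : IsCompact K) (hKq : K ⊆ Ioi 0 ×ˢ Ioi 0) :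
    ∃ C : ℝ, 0 < C ∧ ∀ r Θ ρ ϑ : ℝ, (r, Θ) ∈ K → 0 < ρ → 0 < ϑ →
      ρ ≤ C * (1 + eos.relEnergyThermo r Θ ρ ϑ) := by
  obtain ⟨δ, m₁, m₂, ρmin, hδ, hm₁, hm₂, hρmin, hK'⟩ := coercivity_constants hG hS hK hKq
  obtain ⟨ρmax, hρmax, hρmaxle⟩ : ∃ ρmax : ℝ, 0 ≤ ρmax ∧ ∀ z ∈ K, |z.1| ≤ ρmax :=
    exists_nonneg_forall_abs_le_of_continuousOn hK continuousOn_fst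
  have habs0 : ∀ a : ℝ, |a - a| ≤ δ := fun a => by simp [hδ.le]
  have hmd : 0 < m₂ * δ := mul_pos hm₂ hδ
  refine ⟨ρmax + δ + 1 / (m₂ * δ), by positivity, fun r Θ ρ ϑ hrΘ hρ hϑ => ?_⟩
  have hr : 0 < r := (hKq hrΘ).1
  have hΘ : 0 < Θ := (hKq hrΘ).2
  have hr_le : r ≤ ρmax := (le_abs_self r).trans (hρmaxle _ hrΘ)
  set R := eos.relEnergyThermo r Θ ρ ϑ with hR
  have hR₀_le : eos.relEnergyThermo r Θ ρ Θ ≤ R := relEnergyThermo_diag_le hG hS hΘ hρ hϑ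
  have hR₀_nonneg : 0 ≤ eos.relEnergyThermo r Θ ρ Θ := relEnergyThermo_diag_nonneg hG hS hr hΘ hρ
  have hR_nonneg : 0 ≤ R := hR₀_nonneg.trans hR₀_le
  have hinv : 0 ≤ 1 / (m₂ * δ) := by positivity
  by_cases hρ' : ρ ≤ r + δ
  · have h1 : ρ ≤ ρmax + δ + 1 / (m₂ * δ) := by linarith
    have h2 : ρmax + δ + 1 / (m₂ * δ) ≤ (ρmax + δ + 1 / (m₂ * δ)) * (1 + R) := by
      have : (0 : ℝ) ≤ ρmax + δ + 1 / (m₂ * δ) := by positivity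
      nlinarith
    linarith
  · have hρ'' : r + δ ≤ ρ := le_of_lt (not_le.1 hρ')
    have hm₂_iso : ∀ ξ ∈ Icc r (r + δ), m₂ ≤ deriv (fun x => eos.p x Θ) ξ / ξ := fun ξ hξ =>
      (hK' r Θ ξ Θ hrΘ (abs_le.2 ⟨by linarith [hξ.1], by linarith [hξ.2]⟩) (habs0 Θ)).2.2.2.2
    have hκ : m₂ * (r + δ - r) ≤ eos.chemPotential (r + δ) Θ - eos.chemPotential r Θ :=
      chemPotential_sub_ge hG hΘ hr (by linarith) hm₂_iso
    have hlin := relEnergyThermo_diag_ge_linear hG hS hr hΘ hδ.le hρ''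
    have hpos : 0 ≤ ρ - r - δ := by linarith
    have h1 : m₂ * δ * (ρ - r - δ) ≤ R := by
      have : m₂ * (r + δ - r) = m₂ * δ := by ring
      rw [this] at hκ
      nlinarith
    have h3 : ρ - r - δ ≤ 1 / (m₂ * δ) * R := by
      rw [one_div, ← div_eq_inv_mul, le_div_iff₀ hmd]
      linarith
    have h4 : 1 / (m₂ * δ) * R ≤ (ρmax + δ + 1 / (m₂ * δ)) * R := by
      have : 1 / (m₂ * δ) ≤ ρmax + δ + 1 / (m₂ * δ) := by linarith
      exact mul_le_mul_of_nonneg_right this hR_nonneg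
    nlinarith

/-- **Internal energy and entropy are controlled by the relative energy** (this is where `e > 0`
enters): for `K ⊂ (0,∞)²` compact there is `C > 0` with `ρ e(ρ,ϑ) ≤ C (1 + ρ + R)` and
`ρ |s(ρ,ϑ)| ≤ C (1 + ρ + R)` for all `(r,Θ) ∈ K`, `ρ, ϑ > 0`, `R = R(ρ,ϑ | r,Θ)`.
[cite: BrezinaFeireisl2018, (3.8)] -/
theorem energy_entropy_le_of_relEnergyThermo (hG : eos.IsGibbs)
    (hS : eos.IsThermodynamicallyStable) (he : ∀ r θ : ℝ, 0 < r → 0 < θ → 0 < eos.e r θ)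
    {K : Set (ℝ × ℝ)} (hK : IsCompact K) (hKq : K ⊆ Ioi 0 ×ˢ Ioi 0) :
    ∃ C : ℝ, 0 < C ∧ ∀ r Θ ρ ϑ : ℝ, (r, Θ) ∈ K → 0 < ρ → 0 < ϑ →
      ρ * eos.e ρ ϑ ≤ C * (1 + ρ + eos.relEnergyThermo r Θ ρ ϑ) ∧
      ρ * |eos.s ρ ϑ| ≤ C * (1 + ρ + eos.relEnergyThermo r Θ ρ ϑ) := by
  -- constants on `K`
  obtain ⟨ρmax, hρmax, hρmaxle⟩ : ∃ ρmax : ℝ, 0 ≤ ρmax ∧ ∀ z ∈ K, |z.1| ≤ ρmax :=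
    exists_nonneg_forall_abs_le_of_continuousOn hK continuousOn_fst
  obtain ⟨Θmin, hΘmin, hΘminle⟩ : ∃ Θmin : ℝ, 0 < Θmin ∧ ∀ z ∈ K, Θmin ≤ z.2 :=
    hK.exists_forall_le' continuousOn_snd fun z hz => (hKq hz).2
  obtain ⟨A₁, hA₁, hA₁le⟩ : ∃ A₁ : ℝ, 0 ≤ A₁ ∧ ∀ z ∈ K, |eos.chemPotential z.1 z.2| ≤ A₁ :=
    exists_nonneg_forall_abs_le_of_continuousOn hK (hG.continuousOn_chemPotential.mono hKq)
  obtain ⟨A₃, hA₃, hA₃le⟩ : ∃ A₃ : ℝ, 0 ≤ A₃ ∧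
      ∀ z ∈ K, |eos.ballisticFreeEnergy z.2 z.1 z.2| ≤ A₃ :=
    exists_nonneg_forall_abs_le_of_continuousOn hK
      (hG.continuousOn_ballisticFreeEnergy_diag.mono hKq)
  have hmaps : MapsTo (fun z : ℝ × ℝ => ((1 : ℝ), 4 * z.2)) K (Ioi 0 ×ˢ Ioi 0) := by
    intro z hz
    have h2 := (hKq hz).2
    simp only [mem_Ioi] at h2
    show ((1 : ℝ), 4 * z.2) ∈ Ioi (0 : ℝ) ×ˢ Ioi (0 : ℝ)
    exact ⟨show (0 : ℝ) < 1 from zero_lt_one, show (0 : ℝ) < 4 * z.2 by linarith⟩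
  have hcont14 : Continuous (fun z : ℝ × ℝ => ((1 : ℝ), 4 * z.2)) := by fun_prop
  obtain ⟨A₄, hA₄, hA₄le⟩ : ∃ A₄ : ℝ, 0 ≤ A₄ ∧ ∀ z ∈ K, |eos.helmholtz 1 (4 * z.2)| ≤ A₄ :=
    exists_nonneg_forall_abs_le_of_continuousOn hK
      (hG.continuousOn_helmholtz.comp hcont14.continuousOn hmaps)
  obtain ⟨A₅, hA₅, hA₅le⟩ : ∃ A₅ : ℝ, 0 ≤ A₅ ∧ ∀ z ∈ K, |eos.chemPotential 1 (4 * z.2)| ≤ A₅ :=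
    exists_nonneg_forall_abs_le_of_continuousOn hK
      (hG.continuousOn_chemPotential.comp hcont14.continuousOn hmaps)
  -- the constants: `C₂` bounds `ρ e`, `C₃` bounds `Θ ρ |s|` (kept opaque: only their
  -- defining inequalities are used below)
  have hA₁ρmax : 0 ≤ A₁ * ρmax := mul_nonneg hA₁ hρmax
  obtain ⟨C₂, hC₂_pos, hC₂a, hC₂b, hC₂c⟩ : ∃ C₂ : ℝ, 0 < C₂ ∧ 6 ≤ C₂ ∧ 4 * A₁ + A₅ ≤ C₂ ∧
      4 * A₁ * ρmax + 4 * A₃ + A₄ + A₅ ≤ C₂ :=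
    ⟨6 + 4 * A₁ + A₅ + 4 * A₁ * ρmax + 4 * A₃ + A₄, by linarith, by linarith, by linarith,
      by linarith⟩
  obtain ⟨C₃, hC₃_pos, hC₃a, hC₃b, hC₃c, hC₃d⟩ : ∃ C₃ : ℝ, 0 < C₃ ∧ C₂ ≤ C₃ ∧ 1 ≤ C₃ ∧
      A₁ ≤ C₃ - C₂ - 1 ∧ A₁ * ρmax + A₃ ≤ C₃ - C₂ - 1 - A₁ :=
    ⟨C₂ + 1 + A₁ + A₁ * ρmax + A₃, by linarith, by linarith, by linarith, by linarith,
      by linarith⟩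
  refine ⟨C₂ + C₃ / Θmin, by positivity, fun r Θ ρ ϑ hrΘ hρ hϑ => ?_⟩
  have hr : 0 < r := (hKq hrΘ).1
  have hΘ : 0 < Θ := (hKq hrΘ).2
  have h2Θ : 0 < 2 * Θ := by linarith
  have h4Θ : 0 < 4 * Θ := by linarith
  have hr_le : r ≤ ρmax := (le_abs_self r).trans (hρmaxle _ hrΘ)
  have hΘmin_le : Θmin ≤ Θ := hΘminle _ hrΘ
  set R := eos.relEnergyThermo r Θ ρ ϑ with hRdef
  have hR₀_le : eos.relEnergyThermo r Θ ρ Θ ≤ R := relEnergyThermo_diag_le hG hS hΘ hρ hϑ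
  have hR₀_nonneg : 0 ≤ eos.relEnergyThermo r Θ ρ Θ := relEnergyThermo_diag_nonneg hG hS hr hΘ hρ
  have hR_nonneg : 0 ≤ R := hR₀_nonneg.trans hR₀_le
  -- bounds on the reference data
  have hμ : |eos.chemPotential r Θ| ≤ A₁ := hA₁le _ hrΘ
  have hH : |eos.ballisticFreeEnergy Θ r Θ| ≤ A₃ := hA₃le _ hrΘ
  have hf4 : |eos.helmholtz 1 (4 * Θ)| ≤ A₄ := hA₄le _ hrΘ
  have hμ4 : |eos.chemPotential 1 (4 * Θ)| ≤ A₅ := hA₅le _ hrΘ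
  have hμρ : |eos.chemPotential r Θ * (ρ - r)| ≤ A₁ * (ρ + ρmax) := by
    rw [abs_mul]
    refine mul_le_mul hμ ?_ (abs_nonneg _) hA₁
    exact (abs_sub _ _).trans (by rw [abs_of_pos hρ, abs_of_pos hr]; linarith)
  have hμ4ρ : |eos.chemPotential 1 (4 * Θ) * (ρ - 1)| ≤ A₅ * (ρ + 1) := by
    rw [abs_mul]
    refine mul_le_mul hμ4 ?_ (abs_nonneg _) hA₅
    exact (abs_sub _ _).trans (by rw [abs_of_pos hρ, abs_one])
  -- e1: `ρ e(ρ,ϑ) ≤ ρ e(ρ,2Θ) + 2R`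
  have he1 : ρ * eos.e ρ ϑ ≤ ρ * eos.e ρ (2 * Θ) + 2 * R := by
    rcases le_or_gt ϑ (2 * Θ) with h | h
    · have h1 := e_le_e_of_le hG hS hρ hϑ h
      have h2 : ρ * eos.e ρ ϑ ≤ ρ * eos.e ρ (2 * Θ) := mul_le_mul_of_nonneg_left h1 hρ.le
      linarith
    · have h1 := energy_sub_le_two_mul_ballisticFreeEnergy_sub hG hS hρ hΘ h.le
      have h2 : eos.ballisticFreeEnergy Θ ρ Θ ≤ eos.ballisticFreeEnergy Θ ρ (2 * Θ) :=
        ballisticFreeEnergy_self_le hG hS hρ h2Θ hΘ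
      have h3 : eos.ballisticFreeEnergy Θ ρ ϑ - eos.ballisticFreeEnergy Θ ρ Θ =
          R - eos.relEnergyThermo r Θ ρ Θ := by
        have := eos.relEnergyThermo_split r Θ ρ ϑ; linarith
      linarith
  -- e2: `ρ e(ρ,2Θ) ≤ 2 ρ f(ρ,2Θ) - ρ f(ρ,4Θ)`
  have he2 : ρ * eos.e ρ (2 * Θ) ≤
      2 * (ρ * eos.helmholtz ρ (2 * Θ)) - ρ * eos.helmholtz ρ (4 * Θ) := by
    have h := e_mul_inv_sub_inv_le hG hS hρ h2Θ (show 2 * Θ ≤ 4 * Θ by linarith)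
    have hΘ' : Θ ≠ 0 := hΘ.ne'
    have e1 : (1 / (2 * Θ) - 1 / (4 * Θ) : ℝ) = 1 / (4 * Θ) := by field_simp; ring
    have e2 : eos.helmholtz ρ (2 * Θ) / (2 * Θ) - eos.helmholtz ρ (4 * Θ) / (4 * Θ) =
        (2 * eos.helmholtz ρ (2 * Θ) - eos.helmholtz ρ (4 * Θ)) * (1 / (4 * Θ)) := by
      field_simp; ring
    rw [e1, e2] at h
    have h' := le_of_mul_le_mul_right h (by positivity : (0 : ℝ) < 1 / (4 * Θ))
    have := mul_le_mul_of_nonneg_left h' hρ.le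
    linarith
  -- e3: `ρ f(ρ,2Θ) ≤ 2 H_Θ(ρ,Θ)`
  have he3 : ρ * eos.helmholtz ρ (2 * Θ) ≤ 2 * eos.ballisticFreeEnergy Θ ρ Θ := by
    have h := e_mul_inv_sub_inv_le hG hS hρ hΘ (show Θ ≤ 2 * Θ by linarith)
    have hΘ' : Θ ≠ 0 := hΘ.ne'
    have hpos : 0 ≤ eos.e ρ Θ * (1 / Θ - 1 / (2 * Θ)) := by
      have : (1 / Θ - 1 / (2 * Θ) : ℝ) = 1 / (2 * Θ) := by field_simp; ring
      rw [this]
      exact mul_nonneg (he ρ Θ hρ hΘ).le (by positivity)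
    have h1 : eos.helmholtz ρ (2 * Θ) / (2 * Θ) ≤ eos.helmholtz ρ Θ / Θ := by linarith
    rw [div_le_div_iff₀ h2Θ hΘ] at h1
    -- `h1 : f(ρ,2Θ) * Θ ≤ f(ρ,Θ) * (2Θ)`
    have h1' : eos.helmholtz ρ (2 * Θ) * Θ ≤ (2 * eos.helmholtz ρ Θ) * Θ := by linarith
    have h2 : eos.helmholtz ρ (2 * Θ) ≤ 2 * eos.helmholtz ρ Θ := le_of_mul_le_mul_right h1' hΘ
    have h3 := mul_le_mul_of_nonneg_left h2 hρ.le
    rw [eos.ballisticFreeEnergy_self]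
    linarith
  -- e4: `-ρ f(ρ,4Θ) ≤ A₄ + A₅ (ρ + 1)`
  have he4 : -(ρ * eos.helmholtz ρ (4 * Θ)) ≤ A₄ + A₅ * (ρ + 1) := by
    have h := relEnergyThermo_diag_nonneg hG hS zero_lt_one h4Θ hρ
    unfold relEnergyThermo at h
    rw [eos.ballisticFreeEnergy_self, eos.ballisticFreeEnergy_self, one_mul] at h
    have h1 := (abs_le.1 hf4).1
    have h2 := (abs_le.1 hμ4ρ).1
    linarith
  -- e5: `H_Θ(ρ,Θ) ≤ R + A₁(ρ + ρmax) + A₃`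
  have he5 : eos.ballisticFreeEnergy Θ ρ Θ ≤ R + A₁ * (ρ + ρmax) + A₃ := by
    have h : eos.ballisticFreeEnergy Θ ρ Θ = eos.relEnergyThermo r Θ ρ Θ +
        eos.chemPotential r Θ * (ρ - r) + eos.ballisticFreeEnergy Θ r Θ := by
      unfold relEnergyThermo; ring
    have h1 := (abs_le.1 hμρ).2
    have h2 := (abs_le.1 hH).2
    linarith
  -- energy bound
  have hsum : 0 ≤ 1 + ρ + R := by positivity
  have hE : ρ * eos.e ρ ϑ ≤ C₂ * (1 + ρ + R) := by
    have h : ρ * eos.e ρ ϑ ≤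
        6 * R + (4 * A₁ + A₅) * ρ + (4 * A₁ * ρmax + 4 * A₃ + A₄ + A₅) := by linarith
    have h1 : 6 * R ≤ C₂ * R := mul_le_mul_of_nonneg_right hC₂a hR_nonneg
    have h2 : (4 * A₁ + A₅) * ρ ≤ C₂ * ρ := mul_le_mul_of_nonneg_right hC₂b hρ.le
    linarith
  -- entropy bound: `Θ ρ s = ρ e - H_Θ(ρ,ϑ)` and `H_Θ(ρ,ϑ) = R + μ(r,Θ)(ρ-r) + H_Θ(r,Θ)`
  have hS' : Θ * (ρ * |eos.s ρ ϑ|) ≤ C₃ * (1 + ρ + R) := by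
    have hid : Θ * (ρ * eos.s ρ ϑ) = ρ * eos.e ρ ϑ - R - eos.chemPotential r Θ * (ρ - r) -
        eos.ballisticFreeEnergy Θ r Θ := by
      simp only [hRdef, relEnergyThermo, ballisticFreeEnergy]; ring
    have hepos : 0 < ρ * eos.e ρ ϑ := mul_pos hρ (he ρ ϑ hρ hϑ)
    have h1 := abs_le.1 hμρ
    have h2 := abs_le.1 hH
    have hC₂sum : 0 ≤ C₂ * (1 + ρ + R) := by positivity
    have habs : Θ * (ρ * |eos.s ρ ϑ|) = |Θ * (ρ * eos.s ρ ϑ)| := by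
      rw [abs_mul, abs_mul, abs_of_pos hΘ, abs_of_pos hρ]
    have hbound : |Θ * (ρ * eos.s ρ ϑ)| ≤ C₂ * (1 + ρ + R) + R + A₁ * (ρ + ρmax) + A₃ := by
      refine abs_le.2 ⟨?_, ?_⟩
      · rw [hid]; linarith
      · rw [hid]; linarith
    -- `C₂(1+ρ+R) + R + A₁ρ + (A₁ρmax + A₃) ≤ C₃(1+ρ+R)`
    have k1 : R ≤ 1 * (1 + ρ + R) := by linarith
    have k2 : A₁ * ρ ≤ A₁ * (1 + ρ + R) := mul_le_mul_of_nonneg_left (by linarith) hA₁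
    have k3 : A₁ * ρmax + A₃ ≤ (A₁ * ρmax + A₃) * (1 + ρ + R) :=
      le_mul_of_one_le_right (by positivity) (by linarith)
    have k4 : (C₂ + 1 + A₁ + (A₁ * ρmax + A₃)) * (1 + ρ + R) ≤ C₃ * (1 + ρ + R) :=
      mul_le_mul_of_nonneg_right (by linarith) hsum
    rw [habs]
    linarith
  refine ⟨?_, ?_⟩
  · have h1 : 0 ≤ C₃ / Θmin := div_nonneg hC₃_pos.le hΘmin.le
    have : C₂ * (1 + ρ + R) ≤ (C₂ + C₃ / Θmin) * (1 + ρ + R) :=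
      mul_le_mul_of_nonneg_right (by linarith) hsum
    linarith
  · -- divide the entropy bound by `Θ ≥ Θmin`
    have h1 : ρ * |eos.s ρ ϑ| ≤ C₃ / Θ * (1 + ρ + R) := by
      rw [div_mul_eq_mul_div, le_div_iff₀ hΘ]
      linarith
    have h2 : C₃ / Θ ≤ C₃ / Θmin := div_le_div_of_nonneg_left hC₃_pos.le hΘmin hΘmin_le
    have h3 : C₃ / Θ * (1 + ρ + R) ≤ (C₂ + C₃ / Θmin) * (1 + ρ + R) :=
      mul_le_mul_of_nonneg_right (by linarith) hsum
    linarith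

end EulerEOS

end CompressibleEuler

end Literature.Analysis.FluidPDE
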